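import Summits.AtomisticToContinuum.Crystallization.Theorems.OverbindingBudgetAffineFarFieldCollarKit
import Summits.AtomisticToContinuum.Crystallization.Theorems.OverbindingBudgetAffineFarFieldCellShell
import Literature.Geometry.DiscreteGeometry.LayerShellPatterns

/-!
# Overbinding budget — far-field Voronoi cells, part 27V-T «CellLattice»: the Voronoi cells of a close-packed stacking

Route `OverbindingBudget`, crux `RobustDefectLimitWindows` (stmt-31280), line (2c), leaf SW♭(30),
part 27V-T, the CONVENTION-BOUND half of item T0′ («reference cells are genuine Voronoi cells»;
generic halves T0′a `voronoiCell_eq_of_far`, T0′b `image_voronoiCell_of_dist_eq` in «CollarKit»).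
For every Hägg sequence `s` (every Barlow stacking `…ABC…/…ABA…/…`, in Hales's normalisation:
in-layer spacing `2`, layer spacing `layerSpacing = 2√(2/3)`, touching balls of radius `1`):
* §1 THE SECOND DISTANCE (any spacing `a > 0`, `h² = ⅔a²`): two points of the stacking that do
  not touch are at distance `≥ √2·a` — the integer distance form
  `F = 3(2P+Q+Λ)² + (3Q+Λ)² + 8K²` (`12·dist² = a²F`, BarlowCoordination) takes no value strictly
  between `12` and `24` (`K = 0`: `F = 12(P²+PQ+Q²)`; `|K| = 1`: `F = 12M + 12`, `M ≥ 0`;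
  `|K| ≥ 2`: `F ≥ 32`); `√2·a` is attained (second neighbours), and equals twice the
  circumradius `a/√2` of the twelve-neighbour cell — exactly the hypothesis `hfar` of T0′a.
* §2 THE CELL: the Voronoi cell of a point `u` of `barlowStacking 2 layerSpacing s` in the whole
  stacking is cut out by its twelve touching neighbours alone and is the moved ideal cell
  `u + A '' idealCell b 2` (`A` a linear isometry carrying the kissing pattern onto the tangent
  arrangement, Literature `IsArrangedIn`; `b = true`, rhombic dodecahedron, at the layers with
  `s (k−1) = s k`; `b = false`, trapezo-rhombic dodecahedron, at `s (k−1) = −s k`) — from T0′a,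
  the Literature tangent-arrangement theorem `kissingShell_barlowStacking_eq_layerShell` +
  `isArrangedIn_layerShell_fcc'/hcp'` (Hales DSP §1.3), and «CellShell» (`shellCell_pattern`,
  circumradius `idealCell b ν ⊆ closedBall 0 (ν/√2)`).
Other spacings `ν` and placements follow by T0′b (similarities map Voronoi cells to Voronoi cells).
-/

namespace Summit.AtomisticToContinuum.Crystallization.Theorems.OverbindingBudgetAffineFarFieldCellLattice

noncomputable section

open Set Metric
open scoped Pointwise
open Literature.Geometry.DiscreteGeometry Literature.MathematicalPhysics.StatisticalMechanics
open Literature.Barriers.AtomisticToContinuum (voronoiCell)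
open Summit.AtomisticToContinuum.Crystallization.Theorems.OverbindingBudgetAffineFarFieldCollarKit
open Summit.AtomisticToContinuum.Crystallization.Theorems.OverbindingBudgetAffineFarFieldCellShell
open Summit.AtomisticToContinuum.Crystallization.Theorems.OverbindingBudgetAffineFarFieldCellVoronoi
open Summit.AtomisticToContinuum.Crystallization.Theorems.OverbindingBudgetAffineFarFieldCellLedgerIdeal
open Summit.AtomisticToContinuum.Crystallization.Theorems.OverbindingBudgetAffineFarFieldCellRD
open Summit.AtomisticToContinuum.Crystallization.Theorems.OverbindingBudgetAffineFarFieldCellTwist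
open Summit.AtomisticToContinuum.Crystallization.Theorems.OverbindingBudgetAffineFarFieldCellTRD

local notation "E3" => EuclideanSpace ℝ (Fin 3)

/-! ## §1 The second distance of a close-packed stacking -/

/-- The adjacent-layer distance form is `12M + 4`, `M = P² + PQ + Q² + σ(P+Q)` (`σ = ±1`). -/
theorem adjLayer_form_eq {P Q σ : ℤ} (hσ : σ = 1 ∨ σ = -1) :
    3 * (2 * P + Q + σ) ^ 2 + (3 * Q + σ) ^ 2 = 12 * (P ^ 2 + P * Q + Q ^ 2 + σ * (P + Q)) + 4 := by
  have h1 : σ ^ 2 = 1 := by rcases hσ with rfl | rfl <;> norm_num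
  linear_combination 4 * h1

/-- The in-layer distance form is `12(P² + PQ + Q²)`. -/
theorem inLayer_form_eq (P Q : ℤ) :
    3 * (2 * P + Q + 0) ^ 2 + (3 * Q + 0) ^ 2 = 12 * (P ^ 2 + P * Q + Q ^ 2) := by ring

/-- ★ SECOND SHELL OF THE DISTANCE FORM: for a Hägg sequence, the integer form
`F = 3(2P+Q+Λ)² + (3Q+Λ)² + 8K²` of two distinct points (`12·dist² = a²F`) is `≥ 24` as soon as it
is `≠ 12` (no distance strictly between `a` and `√2·a`). -/
theorem twentyfour_le_form {s : ℤ → ℤ} (hs : IsHaggSeq s) {k i j k' i' j' : ℤ}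
    (hne : (k, i, j) ≠ (k', i', j'))
    (hF : 3 * (2 * (i - i') + (j - j') + (haggLabel s k - haggLabel s k')) ^ 2 +
        (3 * (j - j') + (haggLabel s k - haggLabel s k')) ^ 2 + 8 * (k - k') ^ 2 ≠ 12) :
    24 ≤ 3 * (2 * (i - i') + (j - j') + (haggLabel s k - haggLabel s k')) ^ 2 +
        (3 * (j - j') + (haggLabel s k - haggLabel s k')) ^ 2 + 8 * (k - k') ^ 2 := by
  set Λ : ℤ := haggLabel s k - haggLabel s k' with hΛ
  rcases lt_trichotomy (k - k') 0 with hK | hK | hK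
  · rcases eq_or_lt_of_le (Int.le_sub_one_iff.2 hK : k - k' ≤ -1) with hK1 | hK1
    · have hk' : k' = k + 1 := by omega
      have hΛ' : Λ = -s k := by rw [hΛ, hk', haggLabel_sub_haggLabel_succ]
      have hσ : -s k = 1 ∨ -s k = -1 := by rcases hs k with h1 | h1 <;> omega
      have hK2 : (k - k') ^ 2 = 1 := by rw [hK1]; norm_num
      rw [hΛ', adjLayer_form_eq hσ, hK2] at hF ⊢
      set M : ℤ := (i - i') ^ 2 + (i - i') * (j - j') + (j - j') ^ 2 + -s k * (i - i' + (j - j'))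
        with hM
      have h4 := four_le_adjLayer (P := i - i') (Q := j - j') hσ
      rw [adjLayer_form_eq hσ] at h4
      have hM1 : M ≠ 0 := fun h0 => hF (by rw [h0]; norm_num)
      omega
    · nlinarith [sq_nonneg (2 * (i - i') + (j - j') + Λ), sq_nonneg (3 * (j - j') + Λ)]
  · have hk' : k' = k := by omega
    have hΛ0 : Λ = 0 := by rw [hΛ, hk', sub_self]
    have hPQ : (i - i', j - j') ≠ (0, 0) := by
      intro h0
      simp only [Prod.mk.injEq, sub_eq_zero] at h0
      exact hne (by rw [hk', h0.1, h0.2])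
    have h12 := twelve_le_inLayer hPQ
    have hK2 : (k - k') ^ 2 = 0 := by rw [hK]; norm_num
    rw [hΛ0, hK2, inLayer_form_eq] at hF ⊢
    rw [← add_zero (2 * (i - i') + (j - j')), ← add_zero (3 * (j - j')), inLayer_form_eq] at h12
    set N : ℤ := (i - i') ^ 2 + (i - i') * (j - j') + (j - j') ^ 2 with hN
    have hN1 : N ≠ 1 := fun h1 => hF (by rw [h1]; norm_num)
    omega
  · rcases eq_or_lt_of_le (Int.add_one_le_iff.2 hK : 1 ≤ k - k') with hK1 | hK1
    · have hk' : k' = k - 1 := by omega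
      have hΛ' : Λ = s (k - 1) := by rw [hΛ, hk', haggLabel_sub_haggLabel_pred]
      have hσ : s (k - 1) = 1 ∨ s (k - 1) = -1 := hs (k - 1)
      have hK2 : (k - k') ^ 2 = 1 := by rw [← hK1]; norm_num
      rw [hΛ', adjLayer_form_eq hσ, hK2] at hF ⊢
      set M : ℤ := (i - i') ^ 2 + (i - i') * (j - j') + (j - j') ^ 2 + s (k - 1) * (i - i' + (j - j'))
        with hM
      have h4 := four_le_adjLayer (P := i - i') (Q := j - j') hσ
      rw [adjLayer_form_eq hσ] at h4
      have hM1 : M ≠ 0 := fun h0 => hF (by rw [h0]; norm_num)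
      omega
    · nlinarith [sq_nonneg (2 * (i - i') + (j - j') + Λ), sq_nonneg (3 * (j - j') + Λ)]

/-- ★ THE SECOND DISTANCE of a close-packed stacking (`a > 0`, `h² = ⅔a²`, Hägg sequence `s`):
two distinct points that do not touch (`dist ≠ a`) are at distance `≥ √2·a`.  Sharp: second
neighbours (in-layer `P² + PQ + Q² = 2` is impossible, but across adjacent layers `M = 1` occurs). -/
theorem sqrt_two_mul_le_dist_barlowPos {a h : ℝ} {s : ℤ → ℤ} (hs : IsHaggSeq s) (ha : 0 < a)
    (hh : h ^ 2 = 2 / 3 * a ^ 2) {k i j k' i' j' : ℤ} (hne : (k, i, j) ≠ (k', i', j'))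
    (hd : dist (barlowPos a h s k i j) (barlowPos a h s k' i' j') ≠ a) :
    Real.sqrt 2 * a ≤ dist (barlowPos a h s k i j) (barlowPos a h s k' i' j') := by
  have h12 := twelve_mul_dist_barlowPos_sq hh s k i j k' i' j'
  have hF := twentyfour_le_form hs hne fun hF => hd ((dist_barlowPos_eq_iff_form ha hh s k i j k' i' j').2 hF)
  have hF' : (24 : ℝ) ≤ ((3 * (2 * (i - i') + (j - j') + (haggLabel s k - haggLabel s k')) ^ 2 +
      (3 * (j - j') + (haggLabel s k - haggLabel s k')) ^ 2 + 8 * (k - k') ^ 2 : ℤ) : ℝ) := by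
    exact_mod_cast hF
  have ha2 : 0 < a ^ 2 := by positivity
  have hd2 : (Real.sqrt 2 * a) ^ 2 ≤ dist (barlowPos a h s k i j) (barlowPos a h s k' i' j') ^ 2 := by
    rw [mul_pow, Real.sq_sqrt zero_le_two]; nlinarith
  exact (pow_le_pow_iff_left₀ (by positivity) dist_nonneg two_ne_zero).1 hd2

/-- The second distance, for points of the stacking given as members of the set. -/
theorem sqrt_two_mul_le_dist_of_mem_barlowStacking {a h : ℝ} {s : ℤ → ℤ} (hs : IsHaggSeq s)
    (ha : 0 < a) (hh : h ^ 2 = 2 / 3 * a ^ 2) {u w : E3} (hu : u ∈ barlowStacking a h s)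
    (hw : w ∈ barlowStacking a h s) (hne : w ≠ u) (hd : dist w u ≠ a) :
    Real.sqrt 2 * a ≤ dist w u := by
  obtain ⟨k, i, j, rfl⟩ := hw
  obtain ⟨k', i', j', rfl⟩ := hu
  refine sqrt_two_mul_le_dist_barlowPos hs ha hh ?_ hd
  rintro heq
  simp only [Prod.mk.injEq] at heq
  obtain ⟨rfl, rfl, rfl⟩ := heq
  exact hne rfl

/-! ## §2 The Voronoi cell of a point of the stacking is the moved ideal cell -/

/-- The bisector test: `dist x u ≤ dist x (u + q) ↔ ⟪x − u, q⟫ ≤ ‖q‖²/2`. -/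
theorem dist_le_dist_add_iff (x u q : E3) :
    dist x u ≤ dist x (u + q) ↔ inner ℝ (x - u) q ≤ ‖q‖ ^ 2 / 2 := by
  rw [← sq_le_sq₀ dist_nonneg dist_nonneg, dist_eq_norm, dist_eq_norm,
    show x - (u + q) = (x - u) - q by abel, norm_sub_sq_real (x - u) q]
  constructor <;> intro H <;> linarith

/-- ★ The cell cut out by a moved, scaled unit pattern `u + ν·A '' P` about `u` is the moved shell
cell `u + A '' shellCell (patternStar P ν) 1` of «CellShell». -/
theorem setOf_dist_le_pattern_eq {P : Finset E3} (hP : ∀ p ∈ P, ‖p‖ = 1) {ν : ℝ} (hν : 0 < ν)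
    (u : E3) (A : E3 ≃ₗᵢ[ℝ] E3) :
    {x | ∀ v ∈ (fun p : E3 => u + ν • A p) '' (P : Set E3), dist x u ≤ dist x v} =
      (fun y => u + A y) '' shellCell (patternStar P ν) 1 := by
  ext x
  simp only [mem_setOf_eq, forall_mem_image, Finset.mem_coe]
  constructor
  · intro hx
    refine ⟨A.symm (x - u), ?_, by simp⟩
    rw [mem_shellCell_patternStar_iff hP hν]
    intro p hp
    have h1 := (dist_le_dist_add_iff x u (ν • A p)).1 (hx hp)
    rw [real_inner_smul_right, norm_smul, Real.norm_of_nonneg hν.le, A.norm_map, hP p hp] at h1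
    rw [← A.inner_map_map, A.apply_symm_apply]
    nlinarith
  · rintro ⟨y, hy, rfl⟩ p hp
    rw [mem_shellCell_patternStar_iff hP hν] at hy
    have h1 := hy p hp
    rw [dist_le_dist_add_iff, add_sub_cancel_left, real_inner_smul_right, norm_smul,
      Real.norm_of_nonneg hν.le, A.norm_map, hP p hp, A.inner_map_map]
    nlinarith

/-- ★★ «CellLattice»: if the tangent arrangement of `u = barlowPos 2 layerSpacing s k i j` in the
close-packed stacking `Z = barlowStacking 2 layerSpacing s` is arranged in a unit pattern `P` whose
shell cell has circumradius `≤ √2` (both kissing patterns, «CellShell»), then for a linear isometry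
`A` realising the arrangement the VORONOI CELL of `u` in the whole stacking is the moved shell cell
`u + A '' shellCell (patternStar P 2) 1` (T0′a: the cell of the twelve neighbours has circumradius
`√2`, every other point is at distance `≥ 2√2`, §1). -/
theorem voronoiCell_barlowStacking_of_isArrangedIn {s : ℤ → ℤ} (hs : IsHaggSeq s) (k i j : ℤ)
    {P : Finset E3} (hP : ∀ p ∈ P, ‖p‖ = 1)
    (hPc : shellCell (patternStar P 2) 1 ⊆ closedBall 0 (2 / Real.sqrt 2))
    (harr : IsArrangedIn (kissingShell (barlowStacking 2 layerSpacing s)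
      (barlowPos 2 layerSpacing s k i j)) P) :
    ∃ A : E3 ≃ₗᵢ[ℝ] E3,
      kissingShell (barlowStacking 2 layerSpacing s) (barlowPos 2 layerSpacing s k i j) =
          (fun p : E3 => (2 : ℝ) • A p) '' (P : Set E3) ∧
        voronoiCell (barlowStacking 2 layerSpacing s) (barlowPos 2 layerSpacing s k i j) =
          (fun y => barlowPos 2 layerSpacing s k i j + A y) '' shellCell (patternStar P 2) 1 := by
  obtain ⟨A₀, hA₀⟩ := harr
  set A : E3 ≃ₗᵢ[ℝ] E3 := A₀.toLinearIsometryEquiv rfl with hAdef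
  have hA : ∀ y, A y = A₀ y := fun y => A₀.toLinearIsometryEquiv_apply rfl y
  set u := barlowPos 2 layerSpacing s k i j with hu
  set Z := barlowStacking 2 layerSpacing s with hZ
  have huZ : u ∈ Z := barlowPos_mem k i j
  have hK : kissingShell Z u = (fun p : E3 => (2 : ℝ) • A p) '' (P : Set E3) := by
    rw [hA₀]; exact image_congr fun p _ => by rw [hA]
  refine ⟨A, hK, ?_⟩
  have hs2 : 0 < Real.sqrt 2 := by positivity
  have e22 : 2 / Real.sqrt 2 = Real.sqrt 2 := by
    rw [div_eq_iff hs2.ne', ← pow_two, Real.sq_sqrt zero_le_two]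
  -- the twelve touching neighbours, as points of the stacking
  set S : Set E3 := (fun p : E3 => u + (2 : ℝ) • A p) '' (P : Set E3) with hSdef
  have hmemK : ∀ x, x ∈ kissingShell Z u ↔ u + x ∈ Z ∧ ‖x‖ = 2 := fun x => Iff.rfl
  have hS : S ⊆ Z := by
    rintro _ ⟨p, hp, rfl⟩
    have : (2 : ℝ) • A p ∈ kissingShell Z u := by rw [hK]; exact ⟨p, hp, rfl⟩
    exact ((hmemK _).1 this).1
  have hcell := setOf_dist_le_pattern_eq hP two_pos u A
  rw [← hcell]
  refine voronoiCell_eq_of_far (r := Real.sqrt 2) hS (fun x hx => ?_) (fun w hw hwS hwu => ?_)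
  · have hx' : x ∈ (fun y => u + A y) '' shellCell (patternStar P 2) 1 := by rw [← hcell]; exact hx
    obtain ⟨y, hy, rfl⟩ := hx'
    have := hPc hy
    rw [mem_closedBall, dist_zero_right, e22] at this
    rwa [dist_eq_norm, add_sub_cancel_left, A.norm_map]
  · have hd : dist w u ≠ 2 := by
      intro hd
      have hwK : w - u ∈ kissingShell Z u :=
        (hmemK _).2 ⟨by rwa [add_sub_cancel], by rwa [← dist_eq_norm]⟩
      rw [hK] at hwK
      obtain ⟨p, hp, hpw⟩ := hwK
      exact hwS ⟨p, hp, by show u + (2 : ℝ) • A p = w; rw [show (2 : ℝ) • A p = w - u from hpw, add_sub_cancel]⟩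
    have h2 := sqrt_two_mul_le_dist_of_mem_barlowStacking hs two_pos layerSpacing_sq' huZ hw hwu hd
    linarith

/-- ★ `k`-SITES: at a layer with `s (k−1) = s k` (letters `ABC`) the Voronoi cell of
`barlowPos 2 layerSpacing s k i j` in the stacking is a moved RHOMBIC DODECAHEDRON
`u + A '' idealCell true 2`, `A` carrying `2·fccKissingPattern` onto the tangent arrangement. -/
theorem voronoiCell_barlowStacking_fcc {s : ℤ → ℤ} (hs : IsHaggSeq s) {k : ℤ} (hk : s (k - 1) = s k)
    (i j : ℤ) :
    ∃ A : E3 ≃ₗᵢ[ℝ] E3,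
      kissingShell (barlowStacking 2 layerSpacing s) (barlowPos 2 layerSpacing s k i j) =
          (fun p : E3 => (2 : ℝ) • A p) '' (fccKissingPattern : Set E3) ∧
        voronoiCell (barlowStacking 2 layerSpacing s) (barlowPos 2 layerSpacing s k i j) =
          (fun y => barlowPos 2 layerSpacing s k i j + A y) '' idealCell true 2 := by
  have hσ : (s k : ℝ) = 1 ∨ (s k : ℝ) = -1 := by
    rcases hs k with h1 | h1 <;> simp [h1]
  have harr : IsArrangedIn (kissingShell (barlowStacking 2 layerSpacing s)
      (barlowPos 2 layerSpacing s k i j)) fccKissingPattern := by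
    rw [kissingShell_barlowStacking_eq_layerShell_fcc hs hk]
    exact isArrangedIn_layerShell_fcc' hσ
  have e := shellCell_fcc (ν := 2) two_pos 1
  rw [one_mul] at e
  rw [← e]
  exact voronoiCell_barlowStacking_of_isArrangedIn hs k i j
    (fun p hp => norm_eq_one_of_mem_fccKissingPattern hp) (shellCell_fcc_subset_closedBall two_pos)
    harr

/-- ★ `h`-SITES: at a layer with `s (k−1) = −s k` (letters `ABA`) the Voronoi cell is a moved
TRAPEZO-RHOMBIC DODECAHEDRON `u + A '' idealCell false 2`, `A` carrying `2·hcpKissingPattern` onto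
the tangent arrangement. -/
theorem voronoiCell_barlowStacking_hcp {s : ℤ → ℤ} (hs : IsHaggSeq s) {k : ℤ}
    (hk : s (k - 1) = -s k) (i j : ℤ) :
    ∃ A : E3 ≃ₗᵢ[ℝ] E3,
      kissingShell (barlowStacking 2 layerSpacing s) (barlowPos 2 layerSpacing s k i j) =
          (fun p : E3 => (2 : ℝ) • A p) '' (hcpKissingPattern : Set E3) ∧
        voronoiCell (barlowStacking 2 layerSpacing s) (barlowPos 2 layerSpacing s k i j) =
          (fun y => barlowPos 2 layerSpacing s k i j + A y) '' idealCell false 2 := by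
  have hσ : (s k : ℝ) = 1 ∨ (s k : ℝ) = -1 := by
    rcases hs k with h1 | h1 <;> simp [h1]
  have harr : IsArrangedIn (kissingShell (barlowStacking 2 layerSpacing s)
      (barlowPos 2 layerSpacing s k i j)) hcpKissingPattern := by
    rw [kissingShell_barlowStacking_eq_layerShell_hcp hs hk]
    exact isArrangedIn_layerShell_hcp' hσ
  have e := shellCell_hcp (ν := 2) two_pos 1
  rw [one_mul] at e
  rw [← e]
  exact voronoiCell_barlowStacking_of_isArrangedIn hs k i j
    (fun p hp => norm_eq_one_of_mem_hcpKissingPattern hp) (shellCell_hcp_subset_closedBall two_pos)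
    harr

/-- ★★ BOTH LETTERS AT ONCE: with `b := (s (k−1) = s k)` (the site is a `k`-site iff the letters
below and above differ), the Voronoi cell of every point of every close-packed Barlow stacking is
the moved ideal cell `u + A '' idealCell b 2` of the ledger («CellLedgerIdeal»), and its tangent
arrangement is `2·A '' (pattern b)`. -/
theorem voronoiCell_barlowStacking {s : ℤ → ℤ} (hs : IsHaggSeq s) (k i j : ℤ) :
    ∃ A : E3 ≃ₗᵢ[ℝ] E3,
      kissingShell (barlowStacking 2 layerSpacing s) (barlowPos 2 layerSpacing s k i j) =
          (fun p : E3 => (2 : ℝ) • A p) ''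
            ((bif decide (s (k - 1) = s k) then fccKissingPattern else hcpKissingPattern :
              Finset E3) : Set E3) ∧
        voronoiCell (barlowStacking 2 layerSpacing s) (barlowPos 2 layerSpacing s k i j) =
          (fun y => barlowPos 2 layerSpacing s k i j + A y) ''
            idealCell (decide (s (k - 1) = s k)) 2 := by
  by_cases hk : s (k - 1) = s k
  · simp only [hk, decide_true, cond_true]
    exact voronoiCell_barlowStacking_fcc hs hk i j
  · have hk' : s (k - 1) = -s k := by
      rcases hs (k - 1) with h1 | h1 <;> rcases hs k with h2 | h2 <;> omega
    simp only [hk, decide_false, cond_false]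
    exact voronoiCell_barlowStacking_hcp hs hk' i j

/-! ## §3 Scaling and placement: the reference cells of 27Vc -/

/-- Dilates of the `k`-cell: `c • rdCell h = rdCell (c·h)` (`c > 0`). -/
theorem smul_rdCell {c : ℝ} (hc : 0 < c) (h : ℝ) : c • rdCell h = rdCell (c * h) := by
  ext x
  rw [mem_smul_set_iff_inv_smul_mem₀ hc.ne', mem_rdCell_iff, mem_rdCell_iff]
  simp only [PiLp.smul_apply, smul_eq_mul, abs_mul, abs_inv, abs_of_pos hc]
  have key : ∀ u v : ℝ, c⁻¹ * u + c⁻¹ * v ≤ 2 * h ↔ u + v ≤ 2 * (c * h) := by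
    intro u v
    rw [← mul_add, inv_mul_le_iff₀ hc]
    constructor <;> intro H <;> linarith
  rw [key, key, key]

/-- Dilates of the `h`-cell: `c • trdCell h = trdCell (c·h)` (`c > 0`; the half-twist is positively
homogeneous). -/
theorem smul_trdCell {c : ℝ} (hc : 0 < c) (h : ℝ) : c • trdCell h = trdCell (c * h) := by
  ext x
  rw [mem_smul_set_iff_inv_smul_mem₀ hc.ne', mem_trdCell, mem_trdCell, halfTwist_smul (inv_pos.2 hc),
    ← smul_rdCell hc, mem_smul_set_iff_inv_smul_mem₀ hc.ne']

/-- Dilates of the ideal cells of the ledger: `c • idealCell b ν = idealCell b (c·ν)` (`c > 0`). -/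
theorem smul_idealCell {c : ℝ} (hc : 0 < c) (b : Bool) (ν : ℝ) :
    c • idealCell b ν = idealCell b (c * ν) := by
  cases b
  · show c • trdCell _ = trdCell _
    rw [smul_trdCell hc, mul_div_assoc]
  · show c • rdCell _ = rdCell _
    rw [smul_rdCell hc, mul_div_assoc]

/-- ★★ THE REFERENCE CELLS OF 27Vc ARE GENUINE VORONOI CELLS: place the close-packed stacking by a
similarity `f x = q + (ν/2)·R x` (`ν > 0` the nearest-neighbour distance, `R` a linear isometry,
`q` a translation).  Then the Voronoi cell of the site `f u`, `u = barlowPos 2 layerSpacing s k i j`,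
in the placed stacking `f '' barlowStacking 2 layerSpacing s` is the placed ideal cell
`f u + R (A '' idealCell b ν)` with `b = (s (k−1) = s k)` and `A` the tangent-arrangement isometry
of `u` (§2 + T0′b + the dilation `(ν/2) • idealCell b 2 = idealCell b ν`). -/
theorem voronoiCell_placed_barlowStacking {s : ℤ → ℤ} (hs : IsHaggSeq s) (k i j : ℤ) {ν : ℝ}
    (hν : 0 < ν) (q : E3) (R : E3 ≃ₗᵢ[ℝ] E3) :
    ∃ A : E3 ≃ₗᵢ[ℝ] E3,
      kissingShell (barlowStacking 2 layerSpacing s) (barlowPos 2 layerSpacing s k i j) =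
          (fun p : E3 => (2 : ℝ) • A p) ''
            ((bif decide (s (k - 1) = s k) then fccKissingPattern else hcpKissingPattern :
              Finset E3) : Set E3) ∧
        voronoiCell ((fun x => q + (ν / 2) • R x) '' barlowStacking 2 layerSpacing s)
            (q + (ν / 2) • R (barlowPos 2 layerSpacing s k i j)) =
          (fun y => (q + (ν / 2) • R (barlowPos 2 layerSpacing s k i j)) + R (A y)) ''
            idealCell (decide (s (k - 1) = s k)) ν := by
  obtain ⟨A, hK, hV⟩ := voronoiCell_barlowStacking hs k i j
  refine ⟨A, hK, ?_⟩
  set u := barlowPos 2 layerSpacing s k i j with hu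
  set b := decide (s (k - 1) = s k) with hb
  set f : E3 → E3 := fun x => q + (ν / 2) • R x with hf
  have hν2 : 0 < ν / 2 := by positivity
  have hdist : ∀ x y, dist (f x) (f y) = ν / 2 * dist x y := by
    intro x y
    rw [hf, dist_eq_norm, dist_eq_norm]
    simp only [add_sub_add_left_eq_sub, ← smul_sub, ← map_sub, norm_smul, R.norm_map,
      Real.norm_of_nonneg hν2.le]
  have hsurj : Function.Surjective f := by
    intro y
    refine ⟨R.symm ((ν / 2)⁻¹ • (y - q)), ?_⟩
    simp only [hf, R.apply_symm_apply, smul_inv_smul₀ hν2.ne', add_sub_cancel]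
  have himg := image_voronoiCell_of_dist_eq (Z := barlowStacking 2 layerSpacing s) (z := u) f hν2
    hdist hsurj
  rw [← himg, hV, image_image,
    show idealCell b ν = (ν / 2) • idealCell b 2 by rw [smul_idealCell hν2, show ν / 2 * 2 = ν by ring],
    ← image_smul, image_image]
  refine image_congr fun y _ => ?_
  simp only [hf, map_add, map_smul, smul_add, add_assoc]

end

end Summit.AtomisticToContinuum.Crystallization.Theorems.OverbindingBudgetAffineFarFieldCellLattice
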